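import Literature.Probability.RandomPlanarGeometry.BDGS2012GrahamLongPieces
import HarnessLib

/-!
# Graham's Borel-type bound for `z_c(d)` (BDGS 2012, (1.20)), XIII: the algebra of the term `A₄`
# (reversion of the fixed-point identity, low-order cancellation, and the tail estimates)

Sibling file of `Literature.Probability.RandomPlanarGeometry.BDGS2012` (fact
`BDGS2012_Graham_criticalPoint_bound` = Graham 2010, Theorem 1), sequel to
`BDGS2012GrahamLongPieces.lean`. With `U = β_c/s = 2d z_c`, the identity of
`BDGS2012GrahamIdentity.lean` reads `U = 1 + Σ_a sgnTotal(a) β_c^a`, and for the lengths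
`a ≤ 2M - 1` one has `sgnTotal(a) β_c^a = Σ_b c_{a,b} s^b U^a` with Graham's `c_{a,b}`
(`grahamC`, `BDGS2012GrahamLemma4.lean`). Writing `U = V(s) + E_M s^{M-1}` with
`V(t) = Σ_{i ≤ M-2} u_i t^i` (`u_i = coefU grahamC i = α_{i+1}`), the term
`A₄ = 1 + Σ_{a ≤ 2M-1} Σ_b c_{a,b} s^b U^a - Σ_{n<M} u_n s^n` of Graham's §6 splits as
`A₄ = HIGH₀ + W`: `W = Σ c_{a,b} s^b (U^a - V(s)^a)` (every term carries a factor `E_M s^{M-1}`),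
and `HIGH₀ = P(s) - Σ_{n<M} u_n s^n` with the polynomial `P(t) = 1 + Σ c_{a,b} t^b V(t)^a`, whose
coefficients of order `< M` are exactly `u_0, …, u_{M-1}` (the reversion recursion `coefU_succ`),
so that `HIGH₀` is a tail `Σ_{n ≥ M} p_n s^n`, estimated by `(s/ρ)^M Σ |c_{a,b}| ρ^b V̂(ρ)^a` for any
`ρ ≥ s` ("Cauchy trick"). This replaces the three groups (sum_1)–(sum_3) of the printed proof.

## What is formalised (namespace `Literature.Probability.RandomPlanarGeometry.SAW.Zd.Graham2010`)

* `abs_pow_sub_pow_le'` (`|x^a - y^a| ≤ a |x-y| R^{a-1}`), `pow_eq_sum_cpow` (weighted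
  `V(t)^a = Σ_m cpow v a m t^m`), `tail_le_of_le_radius` (the Cauchy trick for finite sums);
* `sgnTotal_mul_pow_eq` — `sgnTotal d a · β^a = (Σ_{b<a} grahamC a b s^b) · (2dβ)^a`, `s = 1/(2d)`;
* `low_cancel` — `1 + Σ_{b,a} c_{a,b} t^b Σ_{m < M-b} cpow v a m t^m = Σ_{n<M} u_n t^n` for the
  truncated coefficient sequence `v` of `V`;
* `highZero_eq`, `abs_highZero_le` — `P(s) - Σ_{n<M} u_n s^n` and its bound;
* `abs_W_le` — `|Σ c_{a,b} s^b (U^a - V^a)| ≤ |U - V| Σ_b b 4^b s^b Σ_a |c_{a,b}|` for `|U|,|V| ≤ 2`.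
-/

noncomputable section

open Finset
open scoped BigOperators

namespace Literature.Probability.RandomPlanarGeometry.SAW.Zd.Graham2010

variable {d : ℕ}

/-! ### Three generic tools -/

/-- `|x^a - y^a| ≤ a |x - y| R^{a-1}` for `|x|, |y| ≤ R`. [folklore] -/
theorem abs_pow_sub_pow_le' {x y R : ℝ} (hx : |x| ≤ R) (hy : |y| ≤ R) :
    ∀ a : ℕ, |x ^ a - y ^ a| ≤ a * |x - y| * R ^ (a - 1) := by
  have hR : 0 ≤ R := (abs_nonneg x).trans hx
  intro a
  induction a with
  | zero => simp
  | succ a ih =>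
    have e : x ^ (a + 1) - y ^ (a + 1) = x * (x ^ a - y ^ a) + (x - y) * y ^ a := by ring
    rw [e]
    calc |x * (x ^ a - y ^ a) + (x - y) * y ^ a|
        ≤ |x| * |x ^ a - y ^ a| + |x - y| * |y| ^ a := by
          refine (abs_add_le _ _).trans (le_of_eq ?_)
          rw [abs_mul, abs_mul, abs_pow]
      _ ≤ R * (a * |x - y| * R ^ (a - 1)) + |x - y| * R ^ a := by
          gcongr
      _ = ((a : ℕ) : ℝ) * |x - y| * (R * R ^ (a - 1)) + |x - y| * R ^ a := by ring
      _ ≤ ((a + 1 : ℕ) : ℝ) * |x - y| * R ^ (a + 1 - 1) := by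
          rw [Nat.add_sub_cancel]
          rcases a with _ | a
          · simp
          · rw [Nat.add_sub_cancel, ← pow_succ']
            push_cast
            nlinarith [abs_nonneg (x - y), pow_nonneg hR (a + 1)]

/-- Weighted coefficient extraction: `(Σ_{k ≤ K} v_k t^k)^a = Σ_{m ≤ L} cpow v a m · t^m` for `v`
supported on `[0, K]` and `L ≥ aK`. [folklore] -/
theorem pow_eq_sum_cpow {v : ℕ → ℝ} {K : ℕ} (hv : ∀ k, K < k → v k = 0) (t : ℝ) (a L : ℕ)
    (hL : a * K ≤ L) :
    (∑ k ∈ Finset.range (K + 1), v k * t ^ k) ^ a = ∑ m ∈ Finset.range (L + 1), cpow v a m * t ^ m := by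
  have h := sum_cpow_eq_pow (f := fun k => v k * t ^ k) (K := K) (fun k hk => by rw [hv k hk, zero_mul]) a L hL
  rw [← h]
  refine Finset.sum_congr rfl fun m _ => ?_
  rw [cpow_mul_pow, mul_comm]

/-- **The Cauchy trick for finite sums**: if `0 ≤ s ≤ ρ` then for nonnegative coefficients,
`Σ_{(b,m) : b + m ≥ M} x_{b,m} s^{b+m} ≤ (s/ρ)^M Σ_{b,m} x_{b,m} ρ^{b+m}`. Here in the form used:
a single term. [folklore] -/
theorem pow_le_pow_mul_ratio {s ρ : ℝ} (hs : 0 ≤ s) (hsρ : s ≤ ρ) {n M : ℕ} (hn : M ≤ n) :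
    s ^ n ≤ (s / ρ) ^ M * ρ ^ n := by
  rcases hsρ.eq_or_lt with rfl | hlt
  · rcases hs.eq_or_lt with rfl | hpos
    · rcases Nat.eq_zero_or_pos n with rfl | hn0
      · have : M = 0 := by omega
        subst this; simp
      · rw [zero_pow hn0.ne']; positivity
    · rw [div_self hpos.ne', one_pow, one_mul]
  · have hρ : 0 < ρ := lt_of_le_of_lt hs hlt
    rw [div_pow, div_mul_eq_mul_div, le_div_iff₀ (by positivity)]
    obtain ⟨k, rfl⟩ := Nat.exists_eq_add_of_le hn
    rw [pow_add, pow_add]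
    have hk : s ^ k ≤ ρ ^ k := pow_le_pow_left₀ hs hsρ k
    calc s ^ M * s ^ k * ρ ^ M = (s ^ M * ρ ^ M) * s ^ k := by ring
      _ ≤ (s ^ M * ρ ^ M) * ρ ^ k := mul_le_mul_of_nonneg_left hk (by positivity)
      _ = s ^ M * (ρ ^ M * ρ ^ k) := by ring

/-! ### `sgnTotal(a) β^a` in Graham's variables -/

/-- **`sgnTotal d a · β^a = (Σ_{b<a} c_{a,b} s^b) · (2dβ)^a`** with `s = 1/(2d)` (`d ≥ 1`): by
`diagTotal_eq_sum_cTyp`, `sgnTotal d a = Σ_j c_{a,a-j} (2d)^j`, and `(2d)^j β^a = s^{a-j} (2dβ)^a`.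
[cite: Graham2010, Section 3, eq. (cab)] -/
theorem sgnTotal_mul_pow_eq (hd : 1 ≤ d) (β : ℝ) (a : ℕ) :
    sgnTotal d a * β ^ a =
      (∑ b ∈ Finset.range a, grahamC a b * (1 / (2 * (d : ℝ))) ^ b) * (2 * (d : ℝ) * β) ^ a := by
  have hd0 : (0 : ℝ) < 2 * (d : ℝ) := by
    have : (1 : ℝ) ≤ d := by exact_mod_cast hd
    linarith
  set s : ℝ := 1 / (2 * (d : ℝ)) with hs
  have hs2d : s * (2 * d) = 1 := by rw [hs]; field_simp
  -- `sgnTotal d a = Σ_{j ∈ Icc 1 (a/2)} grahamC a (a - j) (2d)^j`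
  have h1 : sgnTotal d a = ∑ j ∈ Finset.Icc 1 (a / 2), grahamC a (a - j) * (2 * (d : ℝ)) ^ j := by
    unfold sgnTotal
    simp_rw [diagTotal_eq_sum_cTyp, Finset.mul_sum]
    rw [Finset.sum_comm]
    refine Finset.sum_congr rfl fun j hj => ?_
    rw [Finset.mem_Icc] at hj
    unfold grahamC
    rw [Finset.sum_mul]
    refine Finset.sum_congr rfl fun M _ => ?_
    rw [show a - (a - j) = j by omega]
    ring
  -- reindex `b = a - j`: `Icc 1 (a/2) → range a`, the other `b` have `grahamC a b = 0`
  have h2 : ∑ j ∈ Finset.Icc 1 (a / 2), grahamC a (a - j) * (2 * (d : ℝ)) ^ j * β ^ a =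
      ∑ b ∈ Finset.range a, grahamC a b * s ^ b * (2 * (d : ℝ) * β) ^ a := by
    -- first rewrite each summand in terms of `b = a - j`
    have hterm : ∀ j ∈ Finset.Icc 1 (a / 2), grahamC a (a - j) * (2 * (d : ℝ)) ^ j * β ^ a =
        grahamC a (a - j) * s ^ (a - j) * (2 * (d : ℝ) * β) ^ a := by
      intro j hj
      rw [Finset.mem_Icc] at hj
      have e : s ^ (a - j) * (2 * (d : ℝ) * β) ^ a = (2 * (d : ℝ)) ^ j * β ^ a := by
        rw [mul_pow, ← mul_assoc, show (2 * (d : ℝ)) ^ a = (2 * (d : ℝ)) ^ (a - j) * (2 * (d : ℝ)) ^ j by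
          rw [← pow_add]; congr 1; omega, ← mul_assoc, ← mul_pow, hs2d, one_pow, one_mul]
      rw [mul_assoc, mul_assoc, e]
    rw [Finset.sum_congr rfl hterm]
    -- now the bijection `j ↦ a - j` onto `{b ∈ range a | a ≤ 2b}`; the remaining `b` vanish
    rw [← Finset.sum_filter_add_sum_filter_not (Finset.range a) (fun b => a ≤ 2 * b)]
    have hzero : ∑ b ∈ (Finset.range a).filter (fun b => ¬ a ≤ 2 * b), grahamC a b * s ^ b * (2 * (d : ℝ) * β) ^ a = 0 := by
      refine Finset.sum_eq_zero fun b hb => ?_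
      rw [Finset.mem_filter] at hb
      rw [grahamC_eq_zero (Or.inr (by omega)), zero_mul, zero_mul]
    rw [hzero, add_zero]
    refine Finset.sum_nbij' (fun j => a - j) (fun b => a - b) ?_ ?_ ?_ ?_ ?_
    · intro j hj
      rw [Finset.mem_Icc] at hj
      rw [Finset.mem_filter, Finset.mem_range]; omega
    · intro b hb
      rw [Finset.mem_filter, Finset.mem_range] at hb
      rw [Finset.mem_Icc]; omega
    · intro j hj
      rw [Finset.mem_Icc] at hj
      omega
    · intro b hb
      rw [Finset.mem_filter, Finset.mem_range] at hb
      omega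
    · intro j _
      rfl
  rw [h1, Finset.sum_mul, h2, Finset.sum_mul]

/-! ### The low-order cancellation -/

/-- **Low-order cancellation**: with `u = coefU c` and `v i = u i` for `i + 2 ≤ M` (`0` beyond),
`1 + Σ_{b=1}^{2M-2} Σ_{a=b+1}^{min(2b,2M-1)} c_{a,b} t^b Σ_{m<M-b} cpow v a m t^m = Σ_{n<M} u_n t^n`
(the orders `< M` of `1 + Σ c_{a,b} t^b V(t)^a` reproduce the reversion recursion `coefU_succ`).
[cite: Graham2010, Section 6 ("we can cancel the powers of `s` below `s^M`")] -/
theorem low_cancel (c : ℕ → ℕ → ℝ) {M : ℕ} (hM : 1 ≤ M) (t : ℝ) :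
    1 + ∑ b ∈ Finset.Icc 1 (2 * M - 2), ∑ a ∈ Finset.Icc (b + 1) (min (2 * b) (2 * M - 1)),
        c a b * t ^ b * ∑ m ∈ Finset.range (M - b),
          cpow (fun i => if i + 2 ≤ M then coefU c i else 0) a m * t ^ m =
      ∑ n ∈ Finset.range M, coefU c n * t ^ n := by
  set v : ℕ → ℝ := fun i => if i + 2 ≤ M then coefU c i else 0 with hv
  -- split off `n = 0`
  rw [Finset.sum_range_eq_add_Ico _ hM, coefU_zero, pow_zero, one_mul]
  congr 1
  -- regroup the left side by `n = b + m ∈ [1, M-1]`, `b ∈ [1, n]`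
  have hregroup : ∑ b ∈ Finset.Icc 1 (2 * M - 2), ∑ a ∈ Finset.Icc (b + 1) (min (2 * b) (2 * M - 1)),
        c a b * t ^ b * ∑ m ∈ Finset.range (M - b), cpow v a m * t ^ m =
      ∑ n ∈ Finset.Ico 1 M, ∑ b ∈ Finset.Icc 1 n, ∑ a ∈ Finset.Icc (b + 1) (min (2 * b) (2 * M - 1)),
        c a b * cpow v a (n - b) * t ^ n := by
    calc ∑ b ∈ Finset.Icc 1 (2 * M - 2), ∑ a ∈ Finset.Icc (b + 1) (min (2 * b) (2 * M - 1)),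
          c a b * t ^ b * ∑ m ∈ Finset.range (M - b), cpow v a m * t ^ m
        = ∑ b ∈ Finset.Icc 1 (2 * M - 2), ∑ n ∈ Finset.Ico b M,
            ∑ a ∈ Finset.Icc (b + 1) (min (2 * b) (2 * M - 1)), c a b * cpow v a (n - b) * t ^ n := by
          refine Finset.sum_congr rfl fun b _ => ?_
          rw [Finset.sum_Ico_eq_sum_range]
          simp_rw [Finset.mul_sum]
          rw [Finset.sum_comm]
          refine Finset.sum_congr rfl fun m _ => Finset.sum_congr rfl fun a _ => ?_
          rw [Nat.add_sub_cancel_left, pow_add]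
          ring
      _ = _ := by
          refine Finset.sum_comm' fun b n => ?_
          simp only [Finset.mem_Icc, Finset.mem_Ico]
          omega
  rw [hregroup]
  refine Finset.sum_congr rfl fun n hn => ?_
  rw [Finset.mem_Ico] at hn
  obtain ⟨n', rfl⟩ : ∃ n', n = n' + 1 := ⟨n - 1, by omega⟩
  rw [coefU_succ, Finset.sum_mul]
  refine Finset.sum_congr rfl fun b hb => ?_
  rw [Finset.mem_Icc] at hb
  rw [Finset.sum_mul, show min (2 * b) (2 * M - 1) = 2 * b by omega]
  refine Finset.sum_congr rfl fun a _ => ?_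
  rw [cpow_congr (f := v) (g := coefU c) (m := n' + 1 - b) (fun i hi => by
    simp only [hv]; rw [if_pos (by omega)]) a (n' + 1 - b) le_rfl]

/-! ### The polynomial `P(t) = 1 + Σ c_{a,b} t^b V(t)^a` and the tail `HIGH₀` -/

/-- The truncated coefficient sequence of `V(t) = Σ_{i+2 ≤ M} u_i t^i`. [cite: Graham2010, Section 6] -/
def vTrunc (c : ℕ → ℕ → ℝ) (M i : ℕ) : ℝ := if i + 2 ≤ M then coefU c i else 0

/-- `vTrunc` vanishes beyond `M - 2`. [folklore] -/
theorem vTrunc_eq_zero {c : ℕ → ℕ → ℝ} {M k : ℕ} (hk : M - 2 < k) : vTrunc c M k = 0 := by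
  unfold vTrunc; rw [if_neg (by omega)]

/-- `V(t) = Σ_{k ≤ M-2} vTrunc k · t^k`. [cite: Graham2010, Section 6] -/
def vPoly (c : ℕ → ℕ → ℝ) (M : ℕ) (t : ℝ) : ℝ := ∑ k ∈ Finset.range (M - 2 + 1), vTrunc c M k * t ^ k

/-- `P(t) = 1 + Σ_{b=1}^{2M-2} Σ_{a=b+1}^{min(2b,2M-1)} c_{a,b} t^b V(t)^a`. [cite: Graham2010, Section 6] -/
def pPoly (c : ℕ → ℕ → ℝ) (M : ℕ) (t : ℝ) : ℝ :=
  1 + ∑ b ∈ Finset.Icc 1 (2 * M - 2), ∑ a ∈ Finset.Icc (b + 1) (min (2 * b) (2 * M - 1)),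
    c a b * t ^ b * vPoly c M t ^ a

/-- The degree bound used: `a (M-2) ≤ 2M²` for `a ≤ 2M - 1`. [folklore] -/
theorem mul_sub_two_le {a M : ℕ} (ha : a ≤ 2 * M - 1) : a * (M - 2) ≤ 2 * M * M :=
  Nat.mul_le_mul (by omega) (Nat.sub_le M 2)

/-- **`HIGH₀ = P(s) - Σ_{n<M} u_n s^n` is the sum of the orders `≥ M`**:
`= Σ_{b,a} c_{a,b} s^b Σ_{m ∈ [M-b, 2M²]} cpow v a m s^m`. [cite: Graham2010, Section 6] -/
theorem highZero_eq (c : ℕ → ℕ → ℝ) {M : ℕ} (hM : 1 ≤ M) (s : ℝ) :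
    pPoly c M s - ∑ n ∈ Finset.range M, coefU c n * s ^ n =
      ∑ b ∈ Finset.Icc 1 (2 * M - 2), ∑ a ∈ Finset.Icc (b + 1) (min (2 * b) (2 * M - 1)),
        c a b * s ^ b * ∑ m ∈ Finset.Ico (M - b) (2 * M * M + 1), cpow (vTrunc c M) a m * s ^ m := by
  rw [sub_eq_iff_eq_add, ← low_cancel c hM s]
  unfold pPoly
  set HIGH := ∑ b ∈ Finset.Icc 1 (2 * M - 2), ∑ a ∈ Finset.Icc (b + 1) (min (2 * b) (2 * M - 1)),
        c a b * s ^ b * ∑ m ∈ Finset.Ico (M - b) (2 * M * M + 1), cpow (vTrunc c M) a m * s ^ m with hHIGH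
  set LOW := ∑ b ∈ Finset.Icc 1 (2 * M - 2), ∑ a ∈ Finset.Icc (b + 1) (min (2 * b) (2 * M - 1)),
        c a b * s ^ b * ∑ m ∈ Finset.range (M - b),
          cpow (fun i => if i + 2 ≤ M then coefU c i else 0) a m * s ^ m with hLOW
  rw [show HIGH + (1 + LOW) = 1 + (LOW + HIGH) by ring]
  congr 1
  rw [hLOW, hHIGH, ← Finset.sum_add_distrib]
  refine Finset.sum_congr rfl fun b hb => ?_
  rw [← Finset.sum_add_distrib]
  refine Finset.sum_congr rfl fun a ha => ?_
  rw [Finset.mem_Icc] at hb ha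
  rw [← mul_add]
  congr 1
  unfold vPoly
  rw [pow_eq_sum_cpow (K := M - 2) (fun k hk => vTrunc_eq_zero hk) s a (2 * M * M)
    (mul_sub_two_le (le_trans ha.2 (min_le_right _ _))), Finset.range_eq_Ico, Finset.range_eq_Ico,
    ← Finset.sum_Ico_consecutive _ (Nat.zero_le (M - b)) (le_trans (Nat.sub_le M b) (by nlinarith [hM]) : M - b ≤ 2 * M * M + 1)]
  rfl

/-- **The bound on `HIGH₀`** ("Cauchy trick"): for `0 ≤ s ≤ ρ`,
`|P(s) - Σ_{n<M} u_n s^n| ≤ (s/ρ)^M Σ_{b,a} |c_{a,b}| ρ^b V̂(ρ)^a` with `V̂(ρ) = Σ_{k ≤ M-2} |v_k| ρ^k`.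
[cite: Graham2010, Section 6] -/
theorem abs_highZero_le (c : ℕ → ℕ → ℝ) {M : ℕ} (hM : 1 ≤ M) {s ρ : ℝ} (hs : 0 ≤ s) (hsρ : s ≤ ρ) :
    |pPoly c M s - ∑ n ∈ Finset.range M, coefU c n * s ^ n| ≤
      (s / ρ) ^ M * ∑ b ∈ Finset.Icc 1 (2 * M - 2), ∑ a ∈ Finset.Icc (b + 1) (min (2 * b) (2 * M - 1)),
        |c a b| * ρ ^ b * (∑ k ∈ Finset.range (M - 2 + 1), |vTrunc c M k| * ρ ^ k) ^ a := by
  have hρ : 0 ≤ ρ := hs.trans hsρ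
  rw [highZero_eq c hM s, Finset.mul_sum]
  refine (Finset.abs_sum_le_sum_abs _ _).trans (Finset.sum_le_sum fun b hb => ?_)
  rw [Finset.mul_sum]
  refine (Finset.abs_sum_le_sum_abs _ _).trans (Finset.sum_le_sum fun a ha => ?_)
  rw [Finset.mem_Icc] at hb ha
  have hvabs : ∀ k, M - 2 < k → (fun k => |vTrunc c M k|) k = 0 := fun k hk => by
    simp only [vTrunc_eq_zero hk, abs_zero]
  rw [pow_eq_sum_cpow (K := M - 2) hvabs ρ a (2 * M * M) (mul_sub_two_le (le_trans ha.2 (min_le_right _ _)))]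
  have hR : (s / ρ) ^ M * (|c a b| * ρ ^ b *
      ∑ m ∈ Finset.range (2 * M * M + 1), cpow (fun k => |vTrunc c M k|) a m * ρ ^ m) =
      ∑ m ∈ Finset.range (2 * M * M + 1),
        (s / ρ) ^ M * (|c a b| * ρ ^ b * (cpow (fun k => |vTrunc c M k|) a m * ρ ^ m)) := by
    rw [Finset.mul_sum, Finset.mul_sum]
  rw [hR]
  -- termwise in `m`
  calc |c a b * s ^ b * ∑ m ∈ Finset.Ico (M - b) (2 * M * M + 1), cpow (vTrunc c M) a m * s ^ m|
      = |c a b| * s ^ b * |∑ m ∈ Finset.Ico (M - b) (2 * M * M + 1), cpow (vTrunc c M) a m * s ^ m| := by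
        rw [abs_mul, abs_mul, abs_pow, abs_of_nonneg hs]
    _ ≤ |c a b| * s ^ b * ∑ m ∈ Finset.Ico (M - b) (2 * M * M + 1), |cpow (vTrunc c M) a m * s ^ m| := by
        gcongr
        exact Finset.abs_sum_le_sum_abs _ _
    _ = ∑ m ∈ Finset.Ico (M - b) (2 * M * M + 1), |c a b| * s ^ b * |cpow (vTrunc c M) a m * s ^ m| := by
        rw [Finset.mul_sum]
    _ ≤ ∑ m ∈ Finset.Ico (M - b) (2 * M * M + 1),
          (s / ρ) ^ M * (|c a b| * ρ ^ b * (cpow (fun k => |vTrunc c M k|) a m * ρ ^ m)) := by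
        refine Finset.sum_le_sum fun m hm => ?_
        rw [Finset.mem_Ico] at hm
        rw [abs_mul, abs_pow, abs_of_nonneg hs]
        have h1 : |cpow (vTrunc c M) a m| ≤ cpow (fun k => |vTrunc c M k|) a m :=
          abs_cpow_le (m := m) (fun i _ => le_rfl) a m le_rfl
        have h2 : s ^ b * s ^ m ≤ (s / ρ) ^ M * (ρ ^ b * ρ ^ m) := by
          rw [← pow_add, ← pow_add]
          exact pow_le_pow_mul_ratio hs hsρ (by omega)
        have hc0 : 0 ≤ |c a b| := abs_nonneg _
        have hcp0 : 0 ≤ cpow (fun k => |vTrunc c M k|) a m := cpow_nonneg' (fun k => abs_nonneg _) a m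
        calc |c a b| * s ^ b * (|cpow (vTrunc c M) a m| * s ^ m)
            = |c a b| * |cpow (vTrunc c M) a m| * (s ^ b * s ^ m) := by ring
          _ ≤ |c a b| * cpow (fun k => |vTrunc c M k|) a m * ((s / ρ) ^ M * (ρ ^ b * ρ ^ m)) := by
              gcongr
          _ = _ := by ring
    _ ≤ ∑ m ∈ Finset.range (2 * M * M + 1),
          (s / ρ) ^ M * (|c a b| * ρ ^ b * (cpow (fun k => |vTrunc c M k|) a m * ρ ^ m)) := by
        refine Finset.sum_le_sum_of_subset_of_nonneg (fun m hm => ?_) fun m _ _ => ?_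
        · rw [Finset.mem_Ico] at hm; rw [Finset.mem_range]; exact hm.2
        · have : 0 ≤ cpow (fun k => |vTrunc c M k|) a m := cpow_nonneg' (fun k => abs_nonneg _) a m
          positivity

/-! ### The term `W` -/

/-- **The bound on `W = Σ c_{a,b} s^b (U^a - V^a)`**: for `|U|, |V| ≤ 2` and `s ≥ 0`,
`|W| ≤ |U - V| · Σ_b (b 4^b) s^b Σ_a |c_{a,b}|` (`|U^a - V^a| ≤ a |U-V| 2^{a-1} ≤ b 4^b |U - V|`
for `a ≤ 2b`). [cite: Graham2010, Section 6] -/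
theorem abs_W_le (c : ℕ → ℕ → ℝ) (M : ℕ) {s U V : ℝ} (hs : 0 ≤ s) (hU : |U| ≤ 2) (hV : |V| ≤ 2) :
    |∑ b ∈ Finset.Icc 1 (2 * M - 2), ∑ a ∈ Finset.Icc (b + 1) (min (2 * b) (2 * M - 1)),
        c a b * s ^ b * (U ^ a - V ^ a)| ≤
      |U - V| * ∑ b ∈ Finset.Icc 1 (2 * M - 2), ((b : ℝ) * 4 ^ b * s ^ b) *
        ∑ a ∈ Finset.Icc (b + 1) (min (2 * b) (2 * M - 1)), |c a b| := by
  rw [Finset.mul_sum]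
  refine (Finset.abs_sum_le_sum_abs _ _).trans (Finset.sum_le_sum fun b hb => ?_)
  rw [Finset.mul_sum, Finset.mul_sum]
  refine (Finset.abs_sum_le_sum_abs _ _).trans (Finset.sum_le_sum fun a ha => ?_)
  rw [Finset.mem_Icc] at hb ha
  have hpow := abs_pow_sub_pow_le' hU hV a
  have ha2 : a ≤ 2 * b := le_trans ha.2 (min_le_left _ _)
  -- `a 2^{a-1} ≤ b 4^b`
  have hcoef : (a : ℝ) * (2 : ℝ) ^ (a - 1) ≤ (b : ℝ) * 4 ^ b := by
    have h1 : (a : ℝ) ≤ 2 * b := by exact_mod_cast ha2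
    have h2 : (2 : ℝ) ^ (a - 1) ≤ 2 ^ (2 * b - 1) := pow_le_pow_right₀ (by norm_num) (by omega)
    have h3 : (2 : ℝ) * 2 ^ (2 * b - 1) = 4 ^ b := by
      rw [← pow_succ', show 2 * b - 1 + 1 = 2 * b by omega, pow_mul]; norm_num
    calc (a : ℝ) * 2 ^ (a - 1) ≤ (2 * b) * 2 ^ (2 * b - 1) := by gcongr
      _ = b * (2 * 2 ^ (2 * b - 1)) := by ring
      _ = b * 4 ^ b := by rw [h3]
  rw [abs_mul, abs_mul, abs_pow, abs_of_nonneg hs]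
  calc |c a b| * s ^ b * |U ^ a - V ^ a| ≤ |c a b| * s ^ b * ((a : ℝ) * |U - V| * 2 ^ (a - 1)) := by gcongr
    _ = (|U - V| * s ^ b * |c a b|) * ((a : ℝ) * 2 ^ (a - 1)) := by ring
    _ ≤ (|U - V| * s ^ b * |c a b|) * ((b : ℝ) * 4 ^ b) := by gcongr
    _ = |U - V| * (((b : ℝ) * 4 ^ b * s ^ b) * |c a b|) := by ring

end Literature.Probability.RandomPlanarGeometry.SAW.Zd.Graham2010
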